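import Summits.QuantumFields.YangMills.Theorems.BalabanUVNodesN16HolderMSLeafSlot
import Summits.QuantumFields.YangMills.Theorems.BalabanUVNodesN16HolderMSAtRecord13
import Summits.QuantumFields.YangMills.Theorems.BalabanUVNodesN16SlotWindowLinear

/-!
# Route «BalabanUVNodes», cluster K4 «SpineRates» — node N16 = NE3: THE MS STUB FROM THE MS SLOT AT THE STAGE-13 HOMES OF RECORD (repair R-β″, record kit (F2-MS)) — slot
# closers at exponent `β` (`InEndRegimeHMS ∧ LeafSlotHolderMS · β` once per family ⇒ `S_N16HolderMS β (RRec₁₃On ∕ RRec₁₃ …)`), THE WINDOW RECIPE for the MS slot (the class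
# radius inside N05's window makes `LeafSlotHolderMS · β` its three content clauses — N05's leaf on `zdGF3 (M_N ℂ) F.L β len`, N07's `LeafH3sup`), the MS proviso at windowed
# letters, ★ THE MS N16 LINE at RR-1's object (`hpin`-generic) and at dag-n22-e's named reading `readingOfRecord₁₃`, and its letter-wise non-vacuity at the MS thresholds

Cell `pub-ymgap`, seat `pub-ymgap-dag-n16-e` (R134 acceleration seat (a), strategy s2 = BY-NAME KNIT at the record; HUMAN RULING D-0062; chair R424 venue), generation 6,
module 26 = (F2-MS) (pub-ymgap INBOX DAGN16E-G6-INTENT-26 l.16577; dag-n16-c g4's division ACK-N16E l.16473), THEOREMS ONLY (0 `def`, 0 `sorry`).  The Stage-13 MS twin of this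
seat's (F2) `…N16HolderSlotWindow` (p485315) and module 20 §5 ∕ module 23 §3, over module 25 `…N16HolderMSLeafSlot` (`LeafSlotHolderMS`, the MS closers), module 24
`…N16HolderMSRegime` (`InEndRegimeHMS`, `radiusOfRecordHMS`, `constOfRecordHMS`), module 22 `…N16HolderMSAtRecord13` (the MS home faces at ₁₃) and file 17 `…N16SlotWindowLinear`
(the slot-free arithmetic `slotLetterLines`, `leafLines_of_linear`).  `--supports stmt-QuantumFields-19912 --as helper`.  `bears_on: R4∕N16 · edge N05 → N16 · out-edge N16 → N21`.

CONTENT.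
§1 CLOSERS AT ONE BUNDLE PER FAMILY — `s_N16HolderMS_rRec₁₃On_of_constLayer_leafSlotHolderMS`, `s_N16HolderMS_rRec₁₃_of_constLayer_leafSlotHolderMS` (module 22's const-layer
  `iff`s `.2` ∘ module 25's closer).
§2 THE WINDOW RECIPE FOR THE MS SLOT — `slotHolderLineMS` (slot-free arithmetic: the MS Hölder threshold `B_h·X + 10·α_{b′}·(B·X) ≤ Λ₂'` from the window line
  `177·α·(B_h + B) ≤ Λ₂'`), `leafSlotHolderMS_ofRecord_of_window_lines` (LINE-EXACT), `leafSlotHolderMS_ofRecord_of_window_linear` (N07's letters linear: `b' ≤ α∕2048`,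
  `c' ≤ α∕24`), `inEndRegimeHMS_ofRecord_of_window`, and per family `inEndRegimeHMS_and_leafSlotHolderMS_ofRecord_of_window_linear` (STAGE-FREE).  ADVISORY CARRIED (dag-ref-B
  READ-468a (iii), dag-ref-I READ-79): as in files 17 ∕ 18 the recipe's witness fills the slot's LOCALISATION letters DEGENERATELY — `Mc := 0`, `C₃₃₅ := 1`, `𝒬 := fun _ ↦ ∅`
  (the `∀ q ∈ 𝒬 k` clause is vacuity over `∅`, not ex falso); a consumer needing a non-trivial `𝒬` gets NOTHING from the recipe and must supply its own slot witness.
§3 ★ THE MS N16 LINE — `s_N16HolderMS_rRec₁₃On_ofRecord_of_window_linear` ∕ `s_N16HolderMS_rRec₁₃_ofRecord_of_window_linear` (reading pinned at RR-1's object, `hpin`-generic)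
  and `s_N16HolderMS_readingOfRecord₁₃On_of_window_linear` ∕ `s_N16HolderMS_readingOfRecord₁₃_of_window_linear` (dag-n22-e's named reading, `rfl`): N05's `Thm4Body` ∕ `Prop3Body`
  on the univ sub-family of `zdGF3 (M_N ℂ) F.L β (len F)` + N07's `LeafH3sup` ONCE per guarded family ⇒ the K3‴ composer's would-be `h16 : S_N16HolderMS β (RRec₁₃On 𝔯 Rg)`
  under R-β″; every other hypothesis a displayed letter line (with the MS length letter `len F (j • e μ) = j`).
§4 `exists_window_letters_numerals_HMS` — the letter lines, the MS proviso and N21's numerals hold TOGETHER at every family ((F2) §4 at the MS thresholds).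

HONEST FRAMING.  Kernel bookkeeping by name; no estimate; N05's `Thm4Body` ∕ `Prop3Body` ([Balaban1985RegularSpaces] Thm 4 ∕ Prop 3 as typed by n05-a, all-torus sub-family,
Hölder member at its PRINTED exponent) and N07's `LeafH3sup` ([Balaban1985Variational] Thm 1 (8)+(10) TYPE) are HYPOTHESES asserted for no family; `S_N16HolderMS β` is dag-n16-c's
CANDIDATE stub wording for R-β″ (UNRULED; nothing of record edited); the reading is a PARAMETER pinned through `hpin` (§3b: dag-n22-e's named reading, whose `w1`∕`ne2`∕`ne1` are
residual DATA); no admissible Stage-13 tuple with provisos is claimed to exist (K0‴ `Record13Inhabited`, stmt-QuantumFields-19909, OPEN); nothing of Bałaban's asserted; **N16 ∕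
NE3 is NOT discharged**; count-neutral (typed 28∕28 · discharged 5∕27, A 5∕28 UNMOVED); one finite four-torus at fixed ε — NOT ℝ⁴, NOT infinite volume, NOT OS, NOT a mass gap,
NOT Clay.  No decl below carries a cite tag (all `[folklore]` bookkeeping).
-/

set_option autoImplicit false

open scoped BigOperators Matrix Matrix.Norms.L2Operator
open NormedSpace

namespace Summit.QuantumFields.YangMills.BalabanUVNodes.N16HolderMSSlotWindow

open Literature.MathematicalPhysics.QuantumFieldTheory.Balaban1983to89
open Literature.MathematicalPhysics.QuantumFieldTheory.Balaban1983to89.T4Continuum (T4Family ULoop)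
open B7Prop1Explicit B7Prop2Explicit
open B7Prop3Flat (c3)
open B8LeafModelZd (ZdIdx)
open B8LeafModelZd3 (zdGF3)
open Node00 (IsDatumOfRecord₁₃C Stage13Params NE3Objects₁₁ NE3Letters₁₁ NE2Objects₁₁ ne3ConstLayerOfRecord₁₁ ne3NperOfRecord₁₁ ne3DomOfRecord₁₁ one_le_ne3NperOfRecord₁₁
  MatA)
open Node00.W1 (ReadingData)
open Summit.QuantumFields.BalabanUV.T4Continuum
open BlockAverageCurrent (curConst curConst_nonneg)
open NE3RightInverseSupLetters (frameC)
open NE3.LeafIndexSockets (LeafH3sup)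
open YMDAG.UVSplit (Datum NE3Carriers NE1pCarriers ne3OfRecord₁₁ RateReading₁₃ RRec₁₃ RRec₁₃On readingOfRecord₁₃ readingOfRecord₁₃_ne3)
open Summit.QuantumFields.YangMills.BalabanUVNodes.N16HolderMSDefs (N16HolderMSAt S_N16HolderMS)
open Summit.QuantumFields.YangMills.BalabanUVNodes.N16HolderMSRegime (InEndRegimeHMS radiusOfRecordHMS constOfRecordHMS inEndRegimeHMS_iff radiusOfRecordHMS_pos
  constOfRecordHMS_nonneg)
open Summit.QuantumFields.YangMills.BalabanUVNodes.N16HolderMSLeafSlot (LeafSlotHolderMS n16HolderMSAt_of_inEndRegimeHMS_leafSlotHolderMS)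
open Summit.QuantumFields.YangMills.BalabanUVNodes.N16SlotWindowLinear (slotLetterLines leafLines_of_linear)
open Summit.QuantumFields.YangMills.BalabanUVNodes.N16HolderMSAtRecord13 (s_N16HolderMS_rRec₁₃On_iff_of_constLayer s_N16HolderMS_rRec₁₃_iff_of_constLayer)

noncomputable section

variable {N : ℕ} [NeZero N]

/-! ## §1 The MS stub from the MS proviso and the MS slot at ONE bundle per family -/

section ConstLayer

variable {β : ℝ} (hβ0 : 0 ≤ β) (hβ1 : β ≤ 1) (𝔯 : RateReading₁₃ N) (Rg : (F : T4Family) → Stage13Params F N → Prop) (o : T4Family → NE3Objects₁₁ N)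
include hβ0 hβ1

/-- **THE KNIT AT A CONSTANT LAYER, MS LEAF FORM, REGIME-RESTRICTED HOME** (`0 ≤ β ≤ 1`): for a reading whose NE3 component is constantly `o F`, the MS proviso
`InEndRegimeHMS` and the MS slot `LeafSlotHolderMS · β` at the ONE bundle `ne3OfRecord₁₁ F (o F)` of every guarded family give `S_N16HolderMS β (RRec₁₃On 𝔯 Rg)` (module 25's
closer once per family under module 22's const-layer face). [folklore] -/
theorem s_N16HolderMS_rRec₁₃On_of_constLayer_leafSlotHolderMS
    (hpin : ∀ (F : T4Family) (θ : Stage13Params F N) (hP : θ.Provisos₁₃ F N) (g₀ : ℕ → ℝ) (os : List (ULoop F)) (k : ℕ), (𝔯.lit F θ hP g₀ os).ne3 k = o F)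
    (h : ∀ (F : T4Family), (∃ θ : Stage13Params F N, θ.Provisos₁₃ F N ∧ Rg F θ ∧ θ.Admissible F N) →
      InEndRegimeHMS (ne3OfRecord₁₁ F (o F)) ∧ LeafSlotHolderMS (ne3OfRecord₁₁ F (o F)) β) :
    S_N16HolderMS β (RRec₁₃On 𝔯 Rg) :=
  (s_N16HolderMS_rRec₁₃On_iff_of_constLayer β 𝔯 Rg o hpin).2 fun F hF => n16HolderMSAt_of_inEndRegimeHMS_leafSlotHolderMS (h F hF).1 hβ0 hβ1 (h F hF).2

/-- **THE KNIT AT A CONSTANT LAYER, MS LEAF FORM, CANONICAL HOME** (`0 ≤ β ≤ 1`). [folklore] -/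
theorem s_N16HolderMS_rRec₁₃_of_constLayer_leafSlotHolderMS
    (hpin : ∀ (F : T4Family) (θ : Stage13Params F N) (hP : θ.Provisos₁₃ F N) (g₀ : ℕ → ℝ) (os : List (ULoop F)) (k : ℕ), (𝔯.lit F θ hP g₀ os).ne3 k = o F)
    (h : ∀ (F : T4Family), (∃ D : Datum F N, IsDatumOfRecord₁₃C F N D) → InEndRegimeHMS (ne3OfRecord₁₁ F (o F)) ∧ LeafSlotHolderMS (ne3OfRecord₁₁ F (o F)) β) :
    S_N16HolderMS β (RRec₁₃ 𝔯) :=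
  (s_N16HolderMS_rRec₁₃_iff_of_constLayer β 𝔯 o hpin).2 fun F hF => n16HolderMSAt_of_inEndRegimeHMS_leafSlotHolderMS (h F hF).1 hβ0 hβ1 (h F hF).2

end ConstLayer

/-! ## §2 The window recipe for the MS slot (line-exact, linear); the MS proviso at windowed letters -/

omit [NeZero N] in
/-- **THE MS HÖLDER THRESHOLD FROM THE WINDOW LINE** (slot-free arithmetic; file 17's `slotLetterLines` gives the `8·` line, the MS slot asks `10·`): for `0 < α ≤ 10⁻⁹`,
`α ≤ Λ₁ ∕ (1770·B + 1)`, `0 < B`, `X < α` and the window line `177·α·(B_h + B) ≤ Λ₂'`: `B_h·(α + 11·4²·α) + 10·X·(B·(α + 11·4²·α)) ≤ Λ₂'` (`α + 11·4²·α = 177·α`, `10·X ≤ 1`).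
[folklore] -/
theorem slotHolderLineMS {B Bh Λ₁ Λ₂' α X : ℝ} (hα : 0 < α) (hα2 : α ≤ Λ₁ / (1770 * B + 1)) (hα5 : α ≤ 1 / 10 ^ 9) (hB0 : 0 < B)
    (hΛ₂' : 177 * α * (Bh + B) ≤ Λ₂') (hXα : X < α) :
    Bh * (α + 11 * (4 : ℝ) ^ 2 * α) + 10 * X * (B * (α + 11 * (4 : ℝ) ^ 2 * α)) ≤ Λ₂' := by
  have hXs : X ≤ 1 / 10 ^ 9 := hXα.le.trans hα5
  have hA0 : 0 ≤ α + 11 * (4 : ℝ) ^ 2 * α := by positivity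
  have hBA0 : 0 ≤ B * (α + 11 * (4 : ℝ) ^ 2 * α) := mul_nonneg hB0.le hA0
  have _hΛ₁ : α * (1770 * B + 1) ≤ Λ₁ := (le_div_iff₀ (by positivity)).1 hα2
  have h10 : 10 * X * (B * (α + 11 * (4 : ℝ) ^ 2 * α)) ≤ B * (α + 11 * (4 : ℝ) ^ 2 * α) := by nlinarith only [hXs, hBA0]
  have e : Bh * (α + 11 * (4 : ℝ) ^ 2 * α) + B * (α + 11 * (4 : ℝ) ^ 2 * α) = 177 * α * (Bh + B) := by ring
  linarith only [h10, e.le, hΛ₂']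

omit [NeZero N] in
/-- **THE WINDOW RECIPE FOR THE MS SLOT, LINE-EXACT** — `LeafSlotHolderMS · β` AT RR-1's OBJECT FROM ITS THREE CONTENT CLAUSES ((F2)'s `leafSlotHolder_ofRecord_of_window_lines`
with the MS length letter `len (j • e μ) = j` and the `10·` Hölder threshold): N07's leaf letters enter only through the slot's four displayed `(b', c')`-lines; `o.ε < α` free;
the numeric lines are file 17's `slotLetterLines` plus `slotHolderLineMS`.  LOCALISATION LETTERS DEGENERATE (`Mc := 0`, `C₃₃₅ := 1`, `𝒬 := fun _ ↦ ∅` — vacuity over `∅`; a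
consumer needing a non-trivial `𝒬` gets nothing from this witness). [folklore] -/
theorem leafSlotHolderMS_ofRecord_of_window_lines (F : T4Family) (o : NE3Objects₁₁ N) {β : ℝ}
    {len : Site 4 → ℝ} (hlen : ∀ v : Site 4, 0 < len v → 1 ≤ len v) (hlenj : ∀ (μ : Fin 4) (j : ℕ), len (j • e μ) = j)
    {c₁ c₁' B₁' cP C₂ B₀β : ℝ} {inp : B8.B9Inputs} (hB₁' : 0 < B₁') (hBB : 5 * ((4 : ℕ) : ℝ) * F.L * inp.B₀ ≤ B₁') (hc₁' : 0 < c₁')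
    (hwin : ∀ α₀ α₁ : ℝ, 0 < α₀ → 0 < α₁ → α₀ + α₁ ≤ c₁' →
      α₀ + α₁ ≤ c₁ ∧ C0 4 * (2 * α₀) ≤ 1 / 3 ∧ 4 * α₀ ≤ c2' 4 F.L ∧ 16 * (B₁' * (α₀ + α₁)) ≤ 1 ∧
      Real.exp (4 * (800 * (((4 : ℕ) : ℝ) + 1) ^ 2 * (((4 : ℕ) : ℝ) + 4)) * α₀) * (1 + 8 * (131072 * (((4 : ℕ) : ℝ) + 1) ^ 2) * (B₁' * (α₀ + α₁))) ≤ 2 ∧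
      2 * (B₁' * (α₀ + α₁)) ≤ c3 4 F.L ∧ ((4 : ℕ) : ℝ) * F.L * α₁ ≤ 1 / 8 ∧ α₀ ≤ cP ∧ α₁ ≤ cP ∧ B₁' * (α₀ + α₁) ≤ cP ∧
      2 * (B₁' * (α₀ + α₁)) ^ 2 + 20 * ((4 : ℕ) : ℝ) * α₀ * (B₁' * (α₀ + α₁)) + 2 * C₂ * (B₁' * (α₀ + α₁)) ^ 2 ≤ α₀ + α₁)
    {α : ℝ} (hα : 0 < α) (hα1 : α ≤ c₁' / 177) (hα2 : α ≤ o.Λ₁ / (1770 * (5 * ((4 : ℕ) : ℝ) * F.L * inp.B₀) + 1))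
    (hα3 : α ≤ c2' 4 F.L / 2) (hα5 : α ≤ 1 / 10 ^ 9)
    (hε : o.ε < α) (hΛ₁ : 0 < o.Λ₁) (hΛ₂' : 177 * α * (5 * ((4 : ℕ) : ℝ) * F.L * B₀β + 5 * ((4 : ℕ) : ℝ) * F.L * inp.B₀) ≤ o.Λ₂')
    {b' c' : ℝ} (hb' : 0 ≤ b') (hc' : 0 ≤ c')
    (hRb : 2 ^ 15 * ((4 : ℝ) + 1) ^ 2 * ((4 : ℝ) + 4) ^ 2 * (F.L : ℝ) ^ 2 * b' ≤ 1)
    (hcF : 23040 * (4 : ℝ) ^ 4 * (frameC 4 F.L + 4) ^ 3 * (c' + curConst 4 F.L * b' ^ 2) ≤ 1)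
    (hXα : b' + 226 * (8 * ((4 : ℝ) + 1) * ((4 : ℝ) + 4)) ^ 2 * b' ^ 2 < α) (hY : 4 * ((4 : ℝ) - 1) * (c' + curConst 4 F.L * b' ^ 2) < α) :
    letI : CStarAlgebra (Matrix (Fin N) (Fin N) ℂ) := {}
    B8.Thm4Body c₁ B₁' (fun i : {i : ZdIdx 4 F.L // i.Ω 0 = Set.univ} => (zdGF3 (Matrix (Fin N) (Fin N) ℂ) F.L β len i.1).toGFData) →
      B8.Prop3Body cP 4 (F.L : ℝ) C₂ inp B₀β
        (fun i : {i : ZdIdx 4 F.L // i.Ω 0 = Set.univ} => (zdGF3 (Matrix (Fin N) (Fin N) ℂ) F.L β len i.1).toGFData2) →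
      LeafH3sup 4 F.L o.Nper o.ε b' c' o.dom →
      LeafSlotHolderMS (ne3OfRecord₁₁ F o) β := by
  letI : CStarAlgebra (Matrix (Fin N) (Fin N) ℂ) := {}
  intro hT hP h3
  have hL0 : (0 : ℝ) < F.L := by have := HistoryFlow.two_le_L F; positivity
  have hB0 : 0 < 5 * ((4 : ℕ) : ℝ) * F.L * inp.B₀ := by have := inp.B₀_pos; positivity
  have h16' : 16 * (B₁' * c₁') ≤ 1 := by
    obtain ⟨-, -, -, h, -⟩ := hwin (c₁' / 2) (c₁' / 2) (by linarith) (by linarith) (by linarith)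
    rwa [add_halves] at h
  obtain ⟨h16, hA3, hA2, hAs, hAc, hMcα, hC335, hss, hgrad, hℓ, -⟩ :=
    slotLetterLines F.L (c' + curConst 4 F.L * b' ^ 2) hα hα1 hα2 hα3 hα5 hB0 hBB hc₁' h16' hΛ₁ hΛ₂' hXα
  have hhol := slotHolderLineMS hα hα2 hα5 hB0 hΛ₂' hXα
  exact ⟨len, c₁, c₁', B₁', cP, C₂, B₀β, inp, _, _, b', c', α, 0, 1, fun _ => ∅, hlen, hlenj, hB₁', hBB, rfl, rfl, h16, hwin,
    hb', hc', hRb, hcF, hα, hA3, hA2, hAs, hAc, hXα, hY, le_rfl, hMcα, fun _ _ hq => hq.elim, hC335, hε, hss, hgrad, hℓ, hhol, hT, hP, h3⟩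

omit [NeZero N] in
/-- **THE WINDOW RECIPE FOR THE MS SLOT, LINEAR** (dag-ref-B READ-445's recipe): N07's leaf letters `0 ≤ b' ≤ α∕2048`, `0 ≤ c' ≤ α∕24`; the class radius `o.ε < α` free, so
N07's linear leaf `b' = c' = C·ε` is admissible at `ε ≤ α∕(2048·C)` (file 17's `leafLines_of_linear`).  Localisation letters degenerate as above. [folklore] -/
theorem leafSlotHolderMS_ofRecord_of_window_linear (F : T4Family) (o : NE3Objects₁₁ N) {β : ℝ}
    {len : Site 4 → ℝ} (hlen : ∀ v : Site 4, 0 < len v → 1 ≤ len v) (hlenj : ∀ (μ : Fin 4) (j : ℕ), len (j • e μ) = j)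
    {c₁ c₁' B₁' cP C₂ B₀β : ℝ} {inp : B8.B9Inputs} (hB₁' : 0 < B₁') (hBB : 5 * ((4 : ℕ) : ℝ) * F.L * inp.B₀ ≤ B₁') (hc₁' : 0 < c₁')
    (hwin : ∀ α₀ α₁ : ℝ, 0 < α₀ → 0 < α₁ → α₀ + α₁ ≤ c₁' →
      α₀ + α₁ ≤ c₁ ∧ C0 4 * (2 * α₀) ≤ 1 / 3 ∧ 4 * α₀ ≤ c2' 4 F.L ∧ 16 * (B₁' * (α₀ + α₁)) ≤ 1 ∧
      Real.exp (4 * (800 * (((4 : ℕ) : ℝ) + 1) ^ 2 * (((4 : ℕ) : ℝ) + 4)) * α₀) * (1 + 8 * (131072 * (((4 : ℕ) : ℝ) + 1) ^ 2) * (B₁' * (α₀ + α₁))) ≤ 2 ∧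
      2 * (B₁' * (α₀ + α₁)) ≤ c3 4 F.L ∧ ((4 : ℕ) : ℝ) * F.L * α₁ ≤ 1 / 8 ∧ α₀ ≤ cP ∧ α₁ ≤ cP ∧ B₁' * (α₀ + α₁) ≤ cP ∧
      2 * (B₁' * (α₀ + α₁)) ^ 2 + 20 * ((4 : ℕ) : ℝ) * α₀ * (B₁' * (α₀ + α₁)) + 2 * C₂ * (B₁' * (α₀ + α₁)) ^ 2 ≤ α₀ + α₁)
    {α : ℝ} (hα : 0 < α) (hα1 : α ≤ c₁' / 177) (hα2 : α ≤ o.Λ₁ / (1770 * (5 * ((4 : ℕ) : ℝ) * F.L * inp.B₀) + 1))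
    (hα3 : α ≤ c2' 4 F.L / 2) (hα4 : α ≤ 1 / ((23040 * (4 : ℝ) ^ 4 * (frameC 4 F.L + 4) ^ 3 + 12) * (1 + curConst 4 F.L) + 1))
    (hα5 : α ≤ 1 / 10 ^ 9)
    (hε : o.ε < α) (hΛ₁ : 0 < o.Λ₁) (hΛ₂' : 177 * α * (5 * ((4 : ℕ) : ℝ) * F.L * B₀β + 5 * ((4 : ℕ) : ℝ) * F.L * inp.B₀) ≤ o.Λ₂')
    {b' c' : ℝ} (hb' : 0 ≤ b') (hb'α : b' ≤ α / 2048) (hc' : 0 ≤ c') (hc'α : c' ≤ α / 24) :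
    letI : CStarAlgebra (Matrix (Fin N) (Fin N) ℂ) := {}
    B8.Thm4Body c₁ B₁' (fun i : {i : ZdIdx 4 F.L // i.Ω 0 = Set.univ} => (zdGF3 (Matrix (Fin N) (Fin N) ℂ) F.L β len i.1).toGFData) →
      B8.Prop3Body cP 4 (F.L : ℝ) C₂ inp B₀β
        (fun i : {i : ZdIdx 4 F.L // i.Ω 0 = Set.univ} => (zdGF3 (Matrix (Fin N) (Fin N) ℂ) F.L β len i.1).toGFData2) →
      LeafH3sup 4 F.L o.Nper o.ε b' c' o.dom →
      LeafSlotHolderMS (ne3OfRecord₁₁ F o) β :=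
  have h := leafLines_of_linear (le_trans one_le_two (HistoryFlow.two_le_L F)) hα hα3 hα4 hα5 hb' hb'α hc'α
  leafSlotHolderMS_ofRecord_of_window_lines F o hlen hlenj hB₁' hBB hc₁' hwin hα hα1 hα2 hα3 hα5 hε hΛ₁ hΛ₂' hb' hc' h.1 h.2.1 h.2.2.1 h.2.2.2

/-- **THE MS PROVISO AT WINDOWED LETTERS**: (F2)'s `inEndRegimeH_ofRecord_of_window` at module 24's MS thresholds — period `≥ 1`, positive coupling letter, class radius
`0 < o.ε < α ≤ o.Λ₁∕(1770·B+1)` (any `B ≥ 0`), `o.Λ₁ ≤ radiusOfRecordHMS N F.L o.Nper`, `0 ≤ o.b ≤ o.ε∕2`, `constOfRecordHMS … ≤ o.C` ⇒ `InEndRegimeHMS (ne3OfRecord₁₁ F o)`.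
[folklore] -/
theorem inEndRegimeHMS_ofRecord_of_window (F : T4Family) (o : NE3Objects₁₁ N) (hN : 1 ≤ o.Nper) (hg : 0 < o.g) {B : ℝ} (hB : 0 ≤ B) {α : ℝ}
    (hα2 : α ≤ o.Λ₁ / (1770 * B + 1)) (hε0 : 0 < o.ε) (hε : o.ε < α) (hΛ₁r : o.Λ₁ ≤ radiusOfRecordHMS N F.L o.Nper)
    (hb0 : 0 ≤ o.b) (hb : o.b ≤ o.ε / 2) (hC : constOfRecordHMS N F.L o.Nper o.g ≤ o.C) :
    InEndRegimeHMS (ne3OfRecord₁₁ F o) := by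
  have hden : 0 < 1770 * B + 1 := by positivity
  have hαΛ : α * (1770 * B + 1) ≤ o.Λ₁ := (le_div_iff₀ hden).1 hα2
  have hα : 0 < α := hε0.trans hε
  have hαΛ' : α ≤ o.Λ₁ := by nlinarith only [hαΛ, hB, hα]
  have hΛ₁ : 0 ≤ o.Λ₁ := by linarith only [hα, hαΛ']
  have hεr : o.ε ≤ radiusOfRecordHMS N F.L o.Nper := by linarith only [hε, hαΛ', hΛ₁r]
  exact (inEndRegimeHMS_iff (ne3OfRecord₁₁ F o)).2 ⟨HistoryFlow.two_le_L F, hN, hg, hε0, hεr, hΛ₁, hΛ₁r, hb0, hb, hC⟩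

/-! ## §3 ★ THE MS N16 LINE — at RR-1's object of record (`hpin`-generic) and at dag-n22-e's named reading `readingOfRecord₁₃`, windowed letters, linear currency -/

section Line

variable {β : ℝ} (hβ0 : 0 ≤ β) (hβ1 : β ≤ 1) (Rg : (F : T4Family) → Stage13Params F N → Prop) (ℓ : T4Family → NE3Letters₁₁)
  -- N05's constants, per family (MS length letter); the averaging letter in N05's window and N07's leaf letters, per family
  {len : T4Family → Site 4 → ℝ} {c₁ c₁' B₁' cP C₂ B₀β : T4Family → ℝ} {inp : T4Family → B8.B9Inputs} {α b' c' : T4Family → ℝ}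
  (hlen : ∀ (F : T4Family) (v : Site 4), 0 < len F v → 1 ≤ len F v) (hlenj : ∀ (F : T4Family) (μ : Fin 4) (j : ℕ), len F (j • e μ) = j)
  (hB₁' : ∀ F, 0 < B₁' F) (hBB : ∀ F : T4Family, 5 * ((4 : ℕ) : ℝ) * F.L * (inp F).B₀ ≤ B₁' F) (hc₁' : ∀ F, 0 < c₁' F)
  (hwin : ∀ (F : T4Family) (α₀ α₁ : ℝ), 0 < α₀ → 0 < α₁ → α₀ + α₁ ≤ c₁' F →
    α₀ + α₁ ≤ c₁ F ∧ C0 4 * (2 * α₀) ≤ 1 / 3 ∧ 4 * α₀ ≤ c2' 4 F.L ∧ 16 * (B₁' F * (α₀ + α₁)) ≤ 1 ∧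
    Real.exp (4 * (800 * (((4 : ℕ) : ℝ) + 1) ^ 2 * (((4 : ℕ) : ℝ) + 4)) * α₀) * (1 + 8 * (131072 * (((4 : ℕ) : ℝ) + 1) ^ 2) * (B₁' F * (α₀ + α₁))) ≤ 2 ∧
    2 * (B₁' F * (α₀ + α₁)) ≤ c3 4 F.L ∧ ((4 : ℕ) : ℝ) * F.L * α₁ ≤ 1 / 8 ∧ α₀ ≤ cP F ∧ α₁ ≤ cP F ∧ B₁' F * (α₀ + α₁) ≤ cP F ∧
    2 * (B₁' F * (α₀ + α₁)) ^ 2 + 20 * ((4 : ℕ) : ℝ) * α₀ * (B₁' F * (α₀ + α₁)) + 2 * C₂ F * (B₁' F * (α₀ + α₁)) ^ 2 ≤ α₀ + α₁)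
  (hα : ∀ F, 0 < α F) (hα1 : ∀ F, α F ≤ c₁' F / 177)
  (hα2 : ∀ F : T4Family, α F ≤ (ℓ F).Λ₁ / (1770 * (5 * ((4 : ℕ) : ℝ) * F.L * (inp F).B₀) + 1))
  (hα3 : ∀ F : T4Family, α F ≤ c2' 4 F.L / 2)
  (hα4 : ∀ F : T4Family, α F ≤ 1 / ((23040 * (4 : ℝ) ^ 4 * (frameC 4 F.L + 4) ^ 3 + 12) * (1 + curConst 4 F.L) + 1))
  (hα5 : ∀ F, α F ≤ 1 / 10 ^ 9)
  (hg : ∀ F, 0 < (ℓ F).g) (hε0 : ∀ F, 0 < (ℓ F).ε) (hε : ∀ F, (ℓ F).ε < α F)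
  (hΛ₁r : ∀ F : T4Family, (ℓ F).Λ₁ ≤ radiusOfRecordHMS N F.L (ne3NperOfRecord₁₁ F 0 0))
  (hb : ∀ F, 0 ≤ (ℓ F).b ∧ (ℓ F).b ≤ (ℓ F).ε / 2) (hC : ∀ F : T4Family, constOfRecordHMS N F.L (ne3NperOfRecord₁₁ F 0 0) (ℓ F).g ≤ (ℓ F).C)
  (hΛ₂' : ∀ F : T4Family, 177 * α F * (5 * ((4 : ℕ) : ℝ) * F.L * B₀β F + 5 * ((4 : ℕ) : ℝ) * F.L * (inp F).B₀) ≤ (ℓ F).Λ₂')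
  (hb' : ∀ F, 0 ≤ b' F ∧ b' F ≤ α F / 2048) (hc' : ∀ F, 0 ≤ c' F ∧ c' F ≤ α F / 24)
include hβ0 hβ1 hlen hlenj hB₁' hBB hc₁' hwin hα hα1 hα2 hα3 hα4 hα5 hg hε0 hε hΛ₁r hb hC hΛ₂' hb' hc'

omit hβ0 hβ1 in
/-- Per family, STAGE-FREE: the MS proviso and — from the content — the MS slot, at the windowed letters `ℓ F` (§2 twice, linear currency). [folklore] -/
theorem inEndRegimeHMS_and_leafSlotHolderMS_ofRecord_of_window_linear (F : T4Family)
    (hT : letI : CStarAlgebra (Matrix (Fin N) (Fin N) ℂ) := {}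
      B8.Thm4Body (c₁ F) (B₁' F) (fun i : {i : ZdIdx 4 F.L // i.Ω 0 = Set.univ} => (zdGF3 (Matrix (Fin N) (Fin N) ℂ) F.L β (len F) i.1).toGFData))
    (hP : letI : CStarAlgebra (Matrix (Fin N) (Fin N) ℂ) := {}
      B8.Prop3Body (cP F) 4 (F.L : ℝ) (C₂ F) (inp F) (B₀β F)
        (fun i : {i : ZdIdx 4 F.L // i.Ω 0 = Set.univ} => (zdGF3 (Matrix (Fin N) (Fin N) ℂ) F.L β (len F) i.1).toGFData2))
    (h3 : LeafH3sup 4 F.L (ne3NperOfRecord₁₁ F 0 0) (ℓ F).ε (b' F) (c' F) (ne3DomOfRecord₁₁ F N 0 0)) :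
    InEndRegimeHMS (ne3OfRecord₁₁ F (ne3ConstLayerOfRecord₁₁ F N (ℓ F))) ∧ LeafSlotHolderMS (ne3OfRecord₁₁ F (ne3ConstLayerOfRecord₁₁ F N (ℓ F))) β := by
  letI : CStarAlgebra (Matrix (Fin N) (Fin N) ℂ) := {}
  have hB0 : 0 < 5 * ((4 : ℕ) : ℝ) * F.L * (inp F).B₀ := by
    have := (inp F).B₀_pos; have := HistoryFlow.two_le_L F; positivity
  refine ⟨inEndRegimeHMS_ofRecord_of_window F (ne3ConstLayerOfRecord₁₁ F N (ℓ F)) (one_le_ne3NperOfRecord₁₁ F 0 0) (hg F) hB0.le (hα2 F) (hε0 F) (hε F)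
    (hΛ₁r F) (hb F).1 (hb F).2 (hC F), ?_⟩
  -- `0 < Λ₁`: `0 < α ≤ Λ₁∕(1770·B+1) ≤ Λ₁`
  have hΛpos : 0 < (ℓ F).Λ₁ := by
    have hBp : 0 < 1770 * (5 * ((4 : ℕ) : ℝ) * F.L * (inp F).B₀) + 1 := by positivity
    have h := (le_div_iff₀ hBp).1 (hα2 F)
    have hαp : 0 < α F := hα F
    nlinarith only [h, hB0, hαp]
  exact leafSlotHolderMS_ofRecord_of_window_linear F (ne3ConstLayerOfRecord₁₁ F N (ℓ F)) (hlen F) (hlenj F) (hB₁' F) (hBB F) (hc₁' F) (hwin F) (hα F) (hα1 F)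
    (hα2 F) (hα3 F) (hα4 F) (hα5 F) (hε F) hΛpos (hΛ₂' F) (hb' F).1 (hb' F).2 (hc' F).1 (hc' F).2 hT hP h3

/-- ★ **THE MS N16 LINE AT THE REGIME-RESTRICTED STAGE-13 HOME, READING PINNED AT RR-1's OBJECT** (`0 ≤ β ≤ 1`; `hpin`-generic) — with windowed letters `ℓ F` (lines displayed),
the three content clauses (N05's `Thm4Body` ∕ `Prop3Body` on the univ sub-family of `zdGF3 (M_N ℂ) F.L β (len F)`, N07's `LeafH3sup` at `(ℓ F).ε, b' F, c' F`) ONCE per guarded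
family give `S_N16HolderMS β (RRec₁₃On 𝔯 Rg)` — the K3‴ composer's would-be `h16` under R-β″. [folklore] -/
theorem s_N16HolderMS_rRec₁₃On_ofRecord_of_window_linear (𝔯 : RateReading₁₃ N)
    (hpin : ∀ (F : T4Family) (θ : Stage13Params F N) (hP : θ.Provisos₁₃ F N) (g₀ : ℕ → ℝ) (os : List (ULoop F)) (k : ℕ),
      (𝔯.lit F θ hP g₀ os).ne3 k = ne3ConstLayerOfRecord₁₁ F N (ℓ F))
    (hcontent : ∀ (F : T4Family), (∃ θ : Stage13Params F N, θ.Provisos₁₃ F N ∧ Rg F θ ∧ θ.Admissible F N) →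
      letI : CStarAlgebra (Matrix (Fin N) (Fin N) ℂ) := {}
      B8.Thm4Body (c₁ F) (B₁' F) (fun i : {i : ZdIdx 4 F.L // i.Ω 0 = Set.univ} => (zdGF3 (Matrix (Fin N) (Fin N) ℂ) F.L β (len F) i.1).toGFData) ∧
        B8.Prop3Body (cP F) 4 (F.L : ℝ) (C₂ F) (inp F) (B₀β F)
          (fun i : {i : ZdIdx 4 F.L // i.Ω 0 = Set.univ} => (zdGF3 (Matrix (Fin N) (Fin N) ℂ) F.L β (len F) i.1).toGFData2) ∧
        LeafH3sup 4 F.L (ne3NperOfRecord₁₁ F 0 0) (ℓ F).ε (b' F) (c' F) (ne3DomOfRecord₁₁ F N 0 0)) :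
    S_N16HolderMS β (RRec₁₃On 𝔯 Rg) :=
  s_N16HolderMS_rRec₁₃On_of_constLayer_leafSlotHolderMS hβ0 hβ1 𝔯 Rg (fun F => ne3ConstLayerOfRecord₁₁ F N (ℓ F)) hpin fun F hF =>
    inEndRegimeHMS_and_leafSlotHolderMS_ofRecord_of_window_linear ℓ hlen hlenj hB₁' hBB hc₁' hwin hα hα1 hα2 hα3 hα4 hα5 hg hε0 hε hΛ₁r hb hC hΛ₂' hb' hc' F
      (hcontent F hF).1 (hcontent F hF).2.1 (hcontent F hF).2.2

/-- **THE MS N16 LINE AT THE CANONICAL STAGE-13 HOME `RRec₁₃ 𝔯`, READING PINNED AT RR-1's OBJECT** (content once per family carrying a Stage-13 datum of record). [folklore] -/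
theorem s_N16HolderMS_rRec₁₃_ofRecord_of_window_linear (𝔯 : RateReading₁₃ N)
    (hpin : ∀ (F : T4Family) (θ : Stage13Params F N) (hP : θ.Provisos₁₃ F N) (g₀ : ℕ → ℝ) (os : List (ULoop F)) (k : ℕ),
      (𝔯.lit F θ hP g₀ os).ne3 k = ne3ConstLayerOfRecord₁₁ F N (ℓ F))
    (hcontent : ∀ (F : T4Family), (∃ D : Datum F N, IsDatumOfRecord₁₃C F N D) →
      letI : CStarAlgebra (Matrix (Fin N) (Fin N) ℂ) := {}
      B8.Thm4Body (c₁ F) (B₁' F) (fun i : {i : ZdIdx 4 F.L // i.Ω 0 = Set.univ} => (zdGF3 (Matrix (Fin N) (Fin N) ℂ) F.L β (len F) i.1).toGFData) ∧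
        B8.Prop3Body (cP F) 4 (F.L : ℝ) (C₂ F) (inp F) (B₀β F)
          (fun i : {i : ZdIdx 4 F.L // i.Ω 0 = Set.univ} => (zdGF3 (Matrix (Fin N) (Fin N) ℂ) F.L β (len F) i.1).toGFData2) ∧
        LeafH3sup 4 F.L (ne3NperOfRecord₁₁ F 0 0) (ℓ F).ε (b' F) (c' F) (ne3DomOfRecord₁₁ F N 0 0)) :
    S_N16HolderMS β (RRec₁₃ 𝔯) :=
  s_N16HolderMS_rRec₁₃_of_constLayer_leafSlotHolderMS hβ0 hβ1 𝔯 (fun F => ne3ConstLayerOfRecord₁₁ F N (ℓ F)) hpin fun F hF =>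
    inEndRegimeHMS_and_leafSlotHolderMS_ofRecord_of_window_linear ℓ hlen hlenj hB₁' hBB hc₁' hwin hα hα1 hα2 hα3 hα4 hα5 hg hε0 hε hΛ₁r hb hC hΛ₂' hb' hc' F
      (hcontent F hF).1 (hcontent F hF).2.1 (hcontent F hF).2.2

variable (w1 : (F : T4Family) → (θ : Stage13Params F N) → ReadingData F (MatA N) θ.τ9.M)
  (ne2 : (F : T4Family) → Stage13Params F N → (ℕ → ℝ) → List (ULoop F) → ℕ → NE2Objects₁₁)
  (ne1 : (F : T4Family) → Stage13Params F N → (ℕ → ℝ) → List (ULoop F) → NE1pCarriers)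

/-- ★ **THE MS N16 LINE AT dag-n22-e's NAMED READING OF RECORD, REGIME-RESTRICTED** (`hpin := readingOfRecord₁₃_ne3`, `rfl`): with the reading's letters `ℓ`, the three content
clauses once per guarded family give `S_N16HolderMS β (RRec₁₃On (readingOfRecord₁₃ w1 ℓ ne2 ne1) Rg)`. [folklore] -/
theorem s_N16HolderMS_readingOfRecord₁₃On_of_window_linear
    (hcontent : ∀ (F : T4Family), (∃ θ : Stage13Params F N, θ.Provisos₁₃ F N ∧ Rg F θ ∧ θ.Admissible F N) →
      letI : CStarAlgebra (Matrix (Fin N) (Fin N) ℂ) := {}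
      B8.Thm4Body (c₁ F) (B₁' F) (fun i : {i : ZdIdx 4 F.L // i.Ω 0 = Set.univ} => (zdGF3 (Matrix (Fin N) (Fin N) ℂ) F.L β (len F) i.1).toGFData) ∧
        B8.Prop3Body (cP F) 4 (F.L : ℝ) (C₂ F) (inp F) (B₀β F)
          (fun i : {i : ZdIdx 4 F.L // i.Ω 0 = Set.univ} => (zdGF3 (Matrix (Fin N) (Fin N) ℂ) F.L β (len F) i.1).toGFData2) ∧
        LeafH3sup 4 F.L (ne3NperOfRecord₁₁ F 0 0) (ℓ F).ε (b' F) (c' F) (ne3DomOfRecord₁₁ F N 0 0)) :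
    S_N16HolderMS β (RRec₁₃On (readingOfRecord₁₃ w1 ℓ ne2 ne1) Rg) :=
  s_N16HolderMS_rRec₁₃On_ofRecord_of_window_linear hβ0 hβ1 Rg ℓ hlen hlenj hB₁' hBB hc₁' hwin hα hα1 hα2 hα3 hα4 hα5 hg hε0 hε hΛ₁r hb hC hΛ₂' hb' hc' _
    (readingOfRecord₁₃_ne3 w1 ℓ ne2 ne1) hcontent

/-- **THE MS N16 LINE AT dag-n22-e's NAMED READING OF RECORD, CANONICAL HOME** (content once per family carrying a Stage-13 datum of record). [folklore] -/
theorem s_N16HolderMS_readingOfRecord₁₃_of_window_linear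
    (hcontent : ∀ (F : T4Family), (∃ D : Datum F N, IsDatumOfRecord₁₃C F N D) →
      letI : CStarAlgebra (Matrix (Fin N) (Fin N) ℂ) := {}
      B8.Thm4Body (c₁ F) (B₁' F) (fun i : {i : ZdIdx 4 F.L // i.Ω 0 = Set.univ} => (zdGF3 (Matrix (Fin N) (Fin N) ℂ) F.L β (len F) i.1).toGFData) ∧
        B8.Prop3Body (cP F) 4 (F.L : ℝ) (C₂ F) (inp F) (B₀β F)
          (fun i : {i : ZdIdx 4 F.L // i.Ω 0 = Set.univ} => (zdGF3 (Matrix (Fin N) (Fin N) ℂ) F.L β (len F) i.1).toGFData2) ∧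
        LeafH3sup 4 F.L (ne3NperOfRecord₁₁ F 0 0) (ℓ F).ε (b' F) (c' F) (ne3DomOfRecord₁₁ F N 0 0)) :
    S_N16HolderMS β (RRec₁₃ (readingOfRecord₁₃ w1 ℓ ne2 ne1)) :=
  s_N16HolderMS_rRec₁₃_ofRecord_of_window_linear hβ0 hβ1 ℓ hlen hlenj hB₁' hBB hc₁' hwin hα hα1 hα2 hα3 hα4 hα5 hg hε0 hε hΛ₁r hb hC hΛ₂' hb' hc' _
    (readingOfRecord₁₃_ne3 w1 ℓ ne2 ne1) hcontent

end Line

/-! ## §4 The windowed letters, the MS proviso and N21's numerals hold TOGETHER -/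

/-- **THE MS N16 LINE IS LETTER-WISE NON-VACUOUS AT THE MS THRESHOLDS** — (F2)'s `exists_window_letters_numerals_H` with `radiusOfRecordH ↦ radiusOfRecordHMS`,
`constOfRecordH ↦ constOfRecordHMS`, `InEndRegimeH ↦ InEndRegimeHMS`: at every family, for every window threshold `c₁' > 0` of N05, every `B9Inputs`, every `B₀β` and every
coupling letter `g > 0` there are an averaging letter `α` and letters `ℓ` meeting EVERY line of §3 together with N21's numerals (`0 < Λ₂'`, `512·5·8·L²·b ≤ 1`) and the MS proviso.
The three content clauses stay hypotheses. [folklore] -/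
theorem exists_window_letters_numerals_HMS (F : T4Family) {c₁' : ℝ} (hc₁' : 0 < c₁') (inp : B8.B9Inputs) (B₀β : ℝ) {g : ℝ} (hg : 0 < g) :
    ∃ (α : ℝ) (ℓ : NE3Letters₁₁),
      0 < α ∧ α ≤ c₁' / 177 ∧ α ≤ ℓ.Λ₁ / (1770 * (5 * ((4 : ℕ) : ℝ) * F.L * inp.B₀) + 1) ∧ α ≤ c2' 4 F.L / 2 ∧
      α ≤ 1 / ((23040 * (4 : ℝ) ^ 4 * (frameC 4 F.L + 4) ^ 3 + 12) * (1 + curConst 4 F.L) + 1) ∧ α ≤ 1 / 10 ^ 9 ∧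
      ℓ.g = g ∧ 0 < ℓ.ε ∧ ℓ.ε < α ∧ ℓ.Λ₁ = radiusOfRecordHMS N F.L (ne3NperOfRecord₁₁ F 0 0) ∧ 0 < ℓ.b ∧ ℓ.b ≤ ℓ.ε / 2 ∧
      ℓ.C = constOfRecordHMS N F.L (ne3NperOfRecord₁₁ F 0 0) g ∧
      177 * α * (5 * ((4 : ℕ) : ℝ) * F.L * B₀β + 5 * ((4 : ℕ) : ℝ) * F.L * inp.B₀) ≤ ℓ.Λ₂' ∧ 0 < ℓ.Λ₂' ∧
      512 * (4 + 1) * (4 + 4) * (F.L : ℝ) ^ 2 * ℓ.b ≤ 1 ∧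
      InEndRegimeHMS (ne3OfRecord₁₁ F (ne3ConstLayerOfRecord₁₁ F N ℓ)) := by
  have hL : 2 ≤ F.L := HistoryFlow.two_le_L F
  have hL0 : (0 : ℝ) < F.L := by exact_mod_cast lt_of_lt_of_le one_pos (le_trans one_le_two hL)
  have hB₀ := inp.B₀_pos
  obtain ⟨r, hr_def, hr⟩ : ∃ r : ℝ, r = radiusOfRecordHMS N F.L (ne3NperOfRecord₁₁ F 0 0) ∧ 0 < r :=
    ⟨_, rfl, radiusOfRecordHMS_pos hL (one_le_ne3NperOfRecord₁₁ F 0 0)⟩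
  obtain ⟨B, hB_def, hB0⟩ : ∃ B : ℝ, B = 5 * ((4 : ℕ) : ℝ) * F.L * inp.B₀ ∧ 0 < B := ⟨_, rfl, by positivity⟩
  obtain ⟨M, hM_def, hM0⟩ : ∃ M : ℝ, M = 23040 * (4 : ℝ) ^ 4 * (frameC 4 F.L + 4) ^ 3 ∧ 0 ≤ M :=
    ⟨_, rfl, by have : 0 ≤ frameC 4 F.L := by unfold frameC; positivity
                positivity⟩
  have hcur : 0 ≤ curConst 4 F.L := curConst_nonneg (d := 4) F.L
  have hc2 : 0 < c2' 4 F.L := c2'_pos 4 F.L (le_trans one_le_two hL)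
  obtain ⟨α, hα, hα1, hα2, hα3, hα4, hα5⟩ : ∃ α : ℝ, 0 < α ∧ α ≤ c₁' / 177 ∧ α ≤ r / (1770 * B + 1) ∧ α ≤ c2' 4 F.L / 2 ∧
      α ≤ 1 / ((M + 12) * (1 + curConst 4 F.L) + 1) ∧ α ≤ 1 / 10 ^ 9 := by
    refine ⟨min (min (c₁' / 177) (r / (1770 * B + 1))) (min (c2' 4 F.L / 2) (min (1 / ((M + 12) * (1 + curConst 4 F.L) + 1)) (1 / 10 ^ 9))),
      lt_min (lt_min (by positivity) (by positivity)) (lt_min (by positivity) (lt_min (by positivity) (by norm_num))), ?_, ?_, ?_, ?_, ?_⟩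
    · exact (min_le_left _ _).trans (min_le_left _ _)
    · exact (min_le_left _ _).trans (min_le_right _ _)
    · exact (min_le_right _ _).trans (min_le_left _ _)
    · exact (min_le_right _ _).trans ((min_le_right _ _).trans (min_le_left _ _))
    · exact (min_le_right _ _).trans ((min_le_right _ _).trans (min_le_right _ _))
  have hαr : α ≤ r := hα2.trans (div_le_self hr.le (by linarith only [hB0]))
  have hK : 0 < 512 * (4 + 1) * (4 + 4) * (F.L : ℝ) ^ 2 := by positivity
  obtain ⟨b, hb_def, hb0, hb1, hb2⟩ : ∃ b : ℝ, b = min (α / 4) (1 / (512 * (4 + 1) * (4 + 4) * (F.L : ℝ) ^ 2)) ∧ 0 < b ∧ b ≤ α / 4 ∧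
      b ≤ 1 / (512 * (4 + 1) * (4 + 4) * (F.L : ℝ) ^ 2) :=
    ⟨_, rfl, lt_min (by positivity) (by positivity), min_le_left _ _, min_le_right _ _⟩
  refine ⟨α, ⟨α / 2, b, g, constOfRecordHMS N F.L (ne3NperOfRecord₁₁ F 0 0) g, r,
      max 1 (177 * α * (5 * ((4 : ℕ) : ℝ) * F.L * B₀β + 5 * ((4 : ℕ) : ℝ) * F.L * inp.B₀))⟩,
    hα, hα1, ?_, hα3, ?_, hα5, rfl, half_pos hα, half_lt_self hα, hr_def, hb0, ?_, rfl, le_max_right _ _, lt_max_of_lt_left one_pos, ?_, ?_⟩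
  · change α ≤ r / (1770 * (5 * ((4 : ℕ) : ℝ) * F.L * inp.B₀) + 1)
    rw [← hB_def]; exact hα2
  · rw [← hM_def]; exact hα4
  · change b ≤ α / 2 / 2
    linarith only [hb1]
  · calc 512 * (4 + 1) * (4 + 4) * (F.L : ℝ) ^ 2 * b
        ≤ 512 * (4 + 1) * (4 + 4) * (F.L : ℝ) ^ 2 * (1 / (512 * (4 + 1) * (4 + 4) * (F.L : ℝ) ^ 2)) := mul_le_mul_of_nonneg_left hb2 hK.le
      _ = 1 := by field_simp
  · refine (inEndRegimeHMS_iff _).2 ⟨hL, one_le_ne3NperOfRecord₁₁ F 0 0, hg, half_pos hα, ?_, hr.le, hr_def.le, hb0.le, ?_, le_rfl⟩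
    · change α / 2 ≤ radiusOfRecordHMS N F.L (ne3NperOfRecord₁₁ F 0 0)
      rw [← hr_def]; linarith only [hαr, hα]
    · change b ≤ α / 2 / 2
      linarith only [hb1]

end

end Summit.QuantumFields.YangMills.BalabanUVNodes.N16HolderMSSlotWindow
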